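import Summits.QuantumFields.YangMills.Theorems.BalabanUVNodesN15KingModelThm33AtRegularFieldIntervalBox

/-!
# N15 (NE2⁺, row s3 KING-MODEL ∕ RIEMANN-KERNEL RUNG) — PART Ζ-c: THE `δ`-PROPAGATOR SMALL FACTOR OF KING's PROOF OF PROPOSITION 3.6
# (p. 665: «δG_k(Ω′, A^{(k)})(x, y) is bounded by C exp[−δ₀|x − y| − δ₀p(L^kε)]») — WHERE THE BACKGROUND ENTERS KING's η-RATE PROOF

count-neutral helper of the pub-ymgap K3⁸ programme (`--supports stmt-QuantumFields-27366`); nothing here is a claim about Bałaban's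
non-abelian `G(U)`, the continuum, ℝ⁴, OS axioms, a mass gap or the Clay problem.  One finite torus `T_ε` at fixed `ε`.

## What is printed, and why it matters for N15

C. King, *The U(1) Higgs model. I. The continuum limit*, Commun. Math. Phys. **102** (1986) 649–677 [King1986].  The η-RATE statements of §3.3
(Props. 3.8∕3.9, NE2's site layer in the model) are proved AT ZERO BACKGROUND ONLY — p. 670 [PDF 22]: *"By using multiple reflection
representations, the propagators … can be written in terms of the operator defined by (2.13) with free boundary conditions (and A = 0, of
course) … so it is sufficient to prove Propositions 3.8 and 3.9 for the operator with free boundary conditions"*.  The BACKGROUND enters the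
proof of Thm 3.4∕3.5 through Thm 3.3's `δ`-propagators at the LIVE field: p. 661 [PDF 13] l. 13–16 *"In the expression E^{(k)}(H, A^{(k)}; {y_i}, {z_j}),
we replace each propagator G_k(A^{(k)}) by the sum G_k(Ω′, A^{(k)}) − δG_k(Ω′, A^{(k)}). … A line carrying δG_k(Ω′, A^{(k)}) (or its derivative) is
treated as external."* and p. 665 [PDF 17] l. 24–27 *"The remainder terms we neglected give large positive powers of L^kε … The propagator
δG_k(Ω′, A^{(k)})(x, y) is bounded by C exp[−δ₀|x − y| − δ₀p(L^kε)], since x, y ∈ □. The propagators δG_k(Ω′, Ω″, (1 − θ)A^{(k)}) and δG_k(Ω, □)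
give a factor exp[−δ₀ dist({x, y}, ∂Ω″)]."*; with (3.41) p. 660: *"when R > p(L^kε), we have exp[−δR] ≤ C(L^kε)^{d+σ}exp[−½δR] for any σ,
since p > 1"*.  Thm 3.3's `δ`-clauses at a regular `A ≠ 0` with the boundary distances LIVE are the rung's g21 theorems
(`thm33Printed_king_regularField_region ∕ _box ∕ _intervalBox`, schema `King1986.ContinuumLimit.Thm33Printed`).

## What this file proves (0 `def`, 0 `sorry`)

* §1 (schema level, any `Thm33Data` with `Thm33Printed`): ★★ `deltaG_smallFactor_of_thm33Printed` — the three `δ`-propagator clauses and the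
  `δC^{(k)}` clause at points `p`-DEEP in `Ω` carry the extra factor `e^{−δ₀p}`: `‖δG f x‖ ≤ C e^{−δ₀dist(x,supp f)}‖f‖·e^{−δ₀p}` (same for
  `D δG`, its transported Hölder quotient, and `|δC^{(k)}(x,y)| ≤ C e^{−δ₀|x−y|}e^{−δ₀p}`), for data whose boundary∕support distances are `≥ 0`.
* §2 `exp_neg_mul_le_rpow` — King's «large positive powers»: `e^{−δ₀p} ≤ s^σ` once `p ≥ (σ/δ₀)·log(1/s)`, `0 < s ≤ 1` (`s = L^kε`, any real `σ`).
* §3 ★★★ **`king_deltaG_smallFactor_intervalBox`** — the instance AT A REGULAR BACKGROUND `A ≠ 0`: on every big-block interval box `Ω ⊂ T_ε` with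
  sides at most half the torus (g21 `thm33Printed_king_regularField_intervalBox`, same hypotheses), there are `δ₀ > 0`, `C` such that for all
  `p`, every bond-closed site `x` with `dist(x, Ωᶜ) ≥ p·L^k` (fine steps) and every test function `f` on the carrier:
  `‖(δG_k(Ω,A)f)(x)‖ ≤ C e^{−δ₀dist(x,supp f)/L^k}‖f‖·e^{−δ₀p}` and `‖(D_{A,μ}δG_k(Ω,A)f)(x)‖ ≤ (same)` — King's p. 665 bound, by name.

HONEST SCOPE.  Bookkeeping on the `δ`-clauses of Thm 3.3 (monotonicity of `exp`); the content is g21's (region∕box Thm 3.3 at a regular `A`) and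
lit-balaban's [Ba1] Props 2.1–2.3 behind it.  This is a SIZE statement at a live background, not an η-rate; it TYPES the locus where King's
η-convergence proof reads the background (LOCATED L-№250-KING, pub-ymgap bus 2026-08-29).  Unit `pub-ymgap-dag-n15-e` g22 (R141 (C) s3), PART Ζ-c.
-/

noncomputable section

open scoped BigOperators

namespace Summit.QuantumFields.YangMills.BalabanUVNodes.N15KingModelRung.RegularField

open Literature.MathematicalPhysics.QuantumFieldTheory.Balaban1983to89
open Literature.MathematicalPhysics.QuantumFieldTheory.Balaban1983to89.HiggsLattice (ChargeData)
open Literature.MathematicalPhysics.QuantumFieldTheory.Balaban1983to89.B1Eq211ZeroFieldTorus (Shape)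
open Literature.MathematicalPhysics.QuantumFieldTheory.Balaban1983to89.B1TorusCubeCover (half)
open Literature.MathematicalPhysics.QuantumFieldTheory.Balaban1983to89.B1Ineq225RegularBox (cellBox)
open Literature.MathematicalPhysics.QuantumFieldTheory.King1986.ContinuumLimit (Thm33Data Thm33Printed)
open Summit.QuantumFields.YangMills.BalabanUVNodes.N15KingModelRung.Curved (VSite bset bdistΩ bdistΩ_nonneg sbdistI sbdistI_nonneg sdistI legsK
  kingThm33DataAlong thm33Printed_king_regularField_intervalBox)

/-! ## §1 Schema level: `δ`-operators `p`-deep in `Ω` carry `e^{−δ₀p}` -/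

section Schema

variable {d : ℕ} {Sk Sη E : Type*} [NormedAddCommGroup E] [NormedSpace ℝ E]

/-- the deep-point weight: `e^{−(δ₀b) − δ₀s} ≤ e^{−δ₀p}` for `b ≥ p`, `s ≥ 0`, `δ₀ ≥ 0`. [cite: King1986, (3.41) p.660, p.665] -/
private theorem exp_bdry_le {δ₀ b s p : ℝ} (hδ₀ : 0 ≤ δ₀) (hb : p ≤ b) (hs : 0 ≤ s) :
    Real.exp (-(δ₀ * b) - δ₀ * s) ≤ Real.exp (-(δ₀ * p)) := by
  rw [Real.exp_le_exp]
  nlinarith [mul_le_mul_of_nonneg_left hb hδ₀, mul_nonneg hδ₀ hs]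

/-- ★★ **THE `δ`-PROPAGATOR CLAUSES OF THEOREM 3.3, `p`-DEEP IN `Ω`** (King p. 665: «δG_k(Ω′, A^{(k)})(x, y) is bounded by C exp[−δ₀|x − y| − δ₀p(L^kε)]»):
for every datum with `Thm33Printed` whose sup norms and support-to-boundary distances are non-negative, there are `δ₀ > 0`, `C ≥ 0` (Thm 3.3's, `C ↦ max C 0`)
such that at every point `x` with `dist(x, ∂Ω) ≥ p` (`D.dbdryη x x ≥ p`): `‖δG f x‖`, `‖D_μδG f x‖ ≤ C e^{−δ₀dist(x,supp f)}‖f‖·e^{−δ₀p}`; for pairs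
`x ≠ y` with `dist({x,y}, ∂Ω) ≥ p` the transported Hölder quotient of `D_μδG f` is `≤ C e^{−δ₀dist({x,y},supp f)}‖f‖·e^{−δ₀p}`; and
`|δC^{(k)}(x,y)| ≤ C e^{−δ₀|x−y|}e^{−δ₀p}` for unit-lattice pairs `p`-deep. [cite: King1986, Thm 3.3 p.656, p.661 l.13–16, p.665 l.24–27] -/
theorem deltaG_smallFactor_of_thm33Printed (D : Thm33Data d Sk Sη E) (hD : Thm33Printed D)
    (hsup : ∀ f, 0 ≤ D.supNorm f) (hsb : ∀ f, 0 ≤ D.dsuppbdry f) :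
    ∃ δ₀ α C : ℝ, 0 < δ₀ ∧ 0 < α ∧ α < 1 ∧ 0 ≤ C ∧
      (∀ (p : ℝ) f x, p ≤ D.dbdryη x x →
        ‖D.δG f x‖ ≤ C * Real.exp (-(δ₀ * D.dsupp f x)) * D.supNorm f * Real.exp (-(δ₀ * p))) ∧
      (∀ (p : ℝ) μ f x, p ≤ D.dbdryη x x →
        ‖D.δDG μ f x‖ ≤ C * Real.exp (-(δ₀ * D.dsupp f x)) * D.supNorm f * Real.exp (-(δ₀ * p))) ∧
      (∀ (p : ℝ) μ f x y, x ≠ y → p ≤ D.dbdryη x y →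
        (D.distη x y) ^ (-α) * ‖D.transport y x (D.δDG μ f x) - D.δDG μ f y‖
          ≤ C * Real.exp (-(δ₀ * D.dsupp2 f x y)) * D.supNorm f * Real.exp (-(δ₀ * p))) ∧
      (∀ (p : ℝ) x y, p ≤ D.dbdryk x y → |D.δcovK x y| ≤ C * Real.exp (-(δ₀ * D.distk x y)) * Real.exp (-(δ₀ * p))) := by
  obtain ⟨δ₀, α, C, hδ₀, hα0, hα1, _h36a, _h36b, _h37, _h37d, _h38, hδC, hδG, hδDG, hδH⟩ := hD
  -- enlarge the constant to `max C 0 ≥ 0`; every right-hand side is monotone in the constant (its other factors are `≥ 0`)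
  have hCle : C ≤ max C 0 := le_max_left _ _
  have hC0 : 0 ≤ max C 0 := le_max_right _ _
  have hmono : ∀ {L e s w w' : ℝ}, L ≤ C * e * s * w → 0 ≤ e → 0 ≤ s → 0 ≤ w → w ≤ w' →
      L ≤ max C 0 * e * s * w' := by
    intro L e s w w' h he hs hw hww'
    have h1 : C * e * s * w ≤ max C 0 * e * s * w :=
      mul_le_mul_of_nonneg_right (mul_le_mul_of_nonneg_right (mul_le_mul_of_nonneg_right hCle he) hs) hw
    have h2 : max C 0 * e * s * w ≤ max C 0 * e * s * w' :=
      mul_le_mul_of_nonneg_left hww' (mul_nonneg (mul_nonneg hC0 he) hs)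
    exact h.trans (h1.trans h2)
  refine ⟨δ₀, α, max C 0, hδ₀, hα0, hα1, hC0, ?_, ?_, ?_, ?_⟩
  · intro p f x hp
    exact hmono (hδG f x) (Real.exp_nonneg _) (hsup f) (Real.exp_nonneg _) (exp_bdry_le hδ₀.le hp (hsb f))
  · intro p μ f x hp
    exact hmono (hδDG μ f x) (Real.exp_nonneg _) (hsup f) (Real.exp_nonneg _) (exp_bdry_le hδ₀.le hp (hsb f))
  · intro p μ f x y hxy hp
    exact hmono (hδH μ f x y hxy) (Real.exp_nonneg _) (hsup f) (Real.exp_nonneg _) (exp_bdry_le hδ₀.le hp (hsb f))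
  · intro p x y hp
    have h := hδC x y
    have hw : Real.exp (-(δ₀ * D.dbdryk x y)) ≤ Real.exp (-(δ₀ * p)) := by
      rw [Real.exp_le_exp]; nlinarith [mul_le_mul_of_nonneg_left hp hδ₀.le]
    have h1 : C * Real.exp (-(δ₀ * D.distk x y)) * Real.exp (-(δ₀ * D.dbdryk x y))
        ≤ max C 0 * Real.exp (-(δ₀ * D.distk x y)) * Real.exp (-(δ₀ * D.dbdryk x y)) :=
      mul_le_mul_of_nonneg_right (mul_le_mul_of_nonneg_right hCle (Real.exp_nonneg _)) (Real.exp_nonneg _)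
    exact h.trans (h1.trans (mul_le_mul_of_nonneg_left hw (mul_nonneg hC0 (Real.exp_nonneg _))))

end Schema

/-! ## §2 «large positive powers of L^kε» -/

/-- **King's (3.41)-type conversion**: for `0 < s ≤ 1`, `δ₀ > 0`, real `σ` and `p ≥ (σ/δ₀)·log(1/s)`: `e^{−δ₀p} ≤ s^σ` — a boundary depth of order
`log(1/(L^kε))` turns the `δ`-propagator factor into any positive power of `L^kε`. [cite: King1986, (3.41) p.660, p.665 «large positive powers of L^kε»] -/
theorem exp_neg_mul_le_rpow {s δ₀ σ p : ℝ} (hs : 0 < s) (hs1 : s ≤ 1) (hδ₀ : 0 < δ₀)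
    (hp : σ / δ₀ * Real.log (1 / s) ≤ p) : Real.exp (-(δ₀ * p)) ≤ s ^ σ := by
  have hlog : Real.log (1 / s) = -Real.log s := by rw [one_div, Real.log_inv]
  rw [Real.rpow_def_of_pos hs, Real.exp_le_exp]
  have hls : Real.log s ≤ 0 := Real.log_nonpos hs.le hs1
  have h1 : σ * Real.log (1 / s) ≤ δ₀ * p := by
    have := mul_le_mul_of_nonneg_left hp hδ₀.le
    rwa [← mul_assoc, mul_div_cancel₀ _ hδ₀.ne'] at this
  rw [hlog] at h1
  have : Real.log s * σ = -(σ * -Real.log s) := by ring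
  linarith

/-! ## §3 The instance at a regular background on big-block interval boxes -/

/-- ★★★ **KING's p. 665 BOUND BY NAME AT A REGULAR BACKGROUND `A ≠ 0`**: on every big-block INTERVAL BOX `Ω = Π_μ[lo_μM, hi_μM) ⊂ T_ε` with sides at
most half the torus (cube size `K₀ ≥ K₀min`, `L ∣ K₀`, cubic torus of r14's sub-family, `K₀ ∣ M_P`, `3K₀ ≤ 2M_P`, level `1 ≤ k < K_P`, `L^kε ≤ 1`) and
every field `A` with one-step differences `≤ δ`, `L^k·δ·|e| ≤ t`: there are `δ₀ > 0`, `C` such that for every depth `p`, every bond-closed site `x` of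
`Ω` with `dist(x, Ωᶜ)/L^k ≥ p` and every test function `f` on the bond-closed carrier, the `δ`-PROPAGATOR `δG_k(Ω, A) = G_k(Ω, A) − G_k(T, A)` obeys
`‖(δG_k f)(x)‖ ≤ C·e^{−δ₀dist(x,supp f)/L^k}·‖f‖·e^{−δ₀p}` and so does `D_{A,μ}δG_k f` — g21's `thm33Printed_king_regularField_intervalBox` read
`p`-deep (§1). [cite: King1986, Thm 3.3 p.656, p.661 l.13–16, p.665 l.24–27] [cite: Balaban1982Higgs1, Prop. 2.1 (2.26) p.610, p.611 l.1–2] -/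
theorem king_deltaG_smallFactor_intervalBox (d L : ℕ) (hd : 1 ≤ d) (hL : Odd L ∧ 1 < L) {a msq : ℝ} (ha : 0 < a) (hmsq : 0 < msq)
    (N : ℕ) (C : ChargeData N) :
    ∃ K₀min : ℕ, ∀ K₀ : ℕ, K₀min ≤ K₀ → L ∣ K₀ → ∃ t : ℝ, 0 < t ∧
      ∀ (P : HiggsLattice.Params) (_S : Shape P), P.d = d → P.L = L → K₀ ∣ P.M → 3 * K₀ ≤ 2 * P.M →
      ∀ {k : ℕ}, 1 ≤ k → k < P.K → P.mesh k ≤ 1 →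
      ∀ (lo hi : Fin P.d → ℕ), (∀ μ, 2 * ((hi μ - lo μ) * half P k K₀) ≤ P.sitesPerDir 0 μ) →
      ∀ (A : HiggsLattice.VecField P 0) {δ : ℝ}, 0 ≤ δ →
        (∀ (z : HiggsLattice.Site P 0) (μ ν : Fin P.d), |A ⟨z.shift ν, μ⟩ - A ⟨z, μ⟩| ≤ δ) →
        (P.L : ℝ) ^ k * δ * |C.e| ≤ t →
        ∃ δ₀ Cst : ℝ, 0 < δ₀ ∧
          ∀ (p : ℝ) (f : VSite (bset (cellBox k K₀ (fun μ => Finset.Ico (lo μ) (hi μ)))) → EuclideanSpace ℝ (Fin N))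
            (x : VSite (bset (cellBox k K₀ (fun μ => Finset.Ico (lo μ) (hi μ))))),
            p ≤ bdistΩ (cellBox k K₀ (fun μ => Finset.Ico (lo μ) (hi μ))) x.1 / (P.L : ℝ) ^ k →
            ‖(kingThm33DataAlong C P k (cellBox k K₀ (fun μ => Finset.Ico (lo μ) (hi μ)))
                (bset (cellBox k K₀ (fun μ => Finset.Ico (lo μ) (hi μ)))) (fun y x => legsK y x) A a msq).δG f x‖
                ≤ Cst * Real.exp (-(δ₀ * (sdistI x f / (P.L : ℝ) ^ k))) * ‖f‖ * Real.exp (-(δ₀ * p)) ∧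
            ∀ μ : Fin P.d,
              ‖(kingThm33DataAlong C P k (cellBox k K₀ (fun μ => Finset.Ico (lo μ) (hi μ)))
                  (bset (cellBox k K₀ (fun μ => Finset.Ico (lo μ) (hi μ)))) (fun y x => legsK y x) A a msq).δDG μ f x‖
                ≤ Cst * Real.exp (-(δ₀ * (sdistI x f / (P.L : ℝ) ^ k))) * ‖f‖ * Real.exp (-(δ₀ * p)) := by
  obtain ⟨K₀min, h⟩ := thm33Printed_king_regularField_intervalBox d L hd hL ha hmsq N C
  refine ⟨K₀min, fun K₀ hK₀ hLK₀ => ?_⟩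
  obtain ⟨t, ht, h'⟩ := h K₀ hK₀ hLK₀
  refine ⟨t, ht, fun P S hPd hPL hK₀M h3M k hk1 hkK hs lo hi hside A δ hδ hreg hle => ?_⟩
  have hT := h' P S hPd hPL hK₀M h3M hk1 hkK hs lo hi hside A hδ hreg hle
  set Ω := cellBox k K₀ (fun μ => Finset.Ico (lo μ) (hi μ)) with hΩ
  set D := kingThm33DataAlong C P k Ω (bset Ω) (fun y x => legsK y x) A a msq with hDdef
  have hsb : ∀ f, 0 ≤ D.dsuppbdry f := fun f =>
    div_nonneg (sbdistI_nonneg Ω f) (pow_nonneg (Nat.cast_nonneg _) _)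
  have hsup : ∀ f, 0 ≤ D.supNorm f := fun f => norm_nonneg f
  obtain ⟨δ₀, α, Cst, hδ₀, _hα0, _hα1, _hC0, hG, hDG, _hH, _hC⟩ := deltaG_smallFactor_of_thm33Printed D hT hsup hsb
  refine ⟨δ₀, Cst, hδ₀, fun p f x hp => ⟨?_, fun μ => ?_⟩⟩
  · have hp' : p ≤ D.dbdryη x x := by
      show p ≤ min (bdistΩ Ω x.1) (bdistΩ Ω x.1) / (P.L : ℝ) ^ k
      rwa [min_self]
    exact hG p f x hp'
  · have hp' : p ≤ D.dbdryη x x := by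
      show p ≤ min (bdistΩ Ω x.1) (bdistΩ Ω x.1) / (P.L : ℝ) ^ k
      rwa [min_self]
    exact hDG p μ f x hp'

end Summit.QuantumFields.YangMills.BalabanUVNodes.N15KingModelRung.RegularField

end
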